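import Literature.AnabelianGeometry.SemiGraphs.ArithTemperedGroupOfOuterAction
import Literature.AnabelianGeometry.SemiGraphs.TemperedExtensionTempered

/-!
# [SemiAnbd] Prop 5.2 (iv): the arithmetic tempered group `π₁^temp(𝒢) ⋊^out Π_A` with its TEMPERED
# topology — algebraic half (abc-iut-w4-d082) + topological half (abc-iut-L3-d2) combined, modulo the
# arithmetic tower

Mochizuki, *Semi-graphs of anabelioids*, Publ. RIMS **42** (2006) 221–322, §0 p. 5, Def 3.1 (i) p. 33,
Def 5.1 (i) p. 62, Prop 5.2 (iii)/(iv) p. 64 [cite: MochizukiSemiAnbd2006, Prop 5.2 (iv), p. 64].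

PROOF-ONLY assembly (no definitions, no named facts) of the producer debt T54-B
(`HOME/plan/GAP-LEDGER.md` G-w4d053-1; sub-DAG `plan/L3/SUBDAG-SemiAnbd-Thm54.md`): on abc-iut-w4-d082's
carrier `Π^temp_𝔊 := outerSemidirectProduct ρ = π₁^temp(𝒢) ⋊^out Π_A` (`ArithTemperedGroupOfOuterAction`,
exactness `outerAction_exact`, Def 5.1 (i) on the chart `arithChartAction_outerAction`) put the tempered
topology of `TemperedExtensionTempered.exists_isTempered_topology_of_kernelSeq` generated by an antitone
sequence of normal subgroups `K n` (the kernels of the actions on the arithmetic tree levels — the tower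
half T54-B-tower, abc-iut-L3-d4, supplies them with: traces `ι⁻¹(K n)` open and cofinal in `π₁^temp(𝒢)`,
images `aug(K n)` open in `Π_A`) and the preimages `aug⁻¹U` of the open normal subgroups of `Π_A`:

* `exists_topology_arithTemperedGroup_of_kernelSeq` — on the SPECIFIC carrier: a topology making
  `π₁^temp(𝒢) ⋊^out Π_A` a tempered topological group with every `K n` open, `ι` a closed embedding,
  `aug` continuous, open and surjective, together with exactness and `ArithChartAction`;
* `exists_arithTemperedGroup_of_kernelSeq` — the literal shape WANTED by G-w4d053-1:
  `∃ (Gtp : Type u) … (ι : π₁^temp 𝒢 →ₜ* Gtp) (aug : Gtp →ₜ* Π_A), Injective ι ∧ range ι = ker aug ∧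
  Surjective aug ∧ IsTempered Gtp ∧ ArithChartAction …`.

Residual inputs, all BINDERS (nothing asserted): `hV`/`hE` (Prop 3.6 (iv) at `ρ_𝔾(a)`), `hopen`
(Def 5.1 (i)(c) on the underlying semi-graph), the kernel sequence with `hK1`/`hK1'`/`hK3` (tower half;
`hK1'` = Def 5.1 (i)(c)(d) continuity, Prop 5.2 (i)(ii)).  Nothing here refers to the IUT corpus; no side
is taken on [IUTchIII] Cor 3.12; typed ≠ proved.
-/

namespace Literature.AnabelianGeometry.SemiGraphs

namespace ProfiniteSemiGraph

open Literature.AnabelianGeometry.EtaleTheta CategoryTheory Topology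

universe u

variable {𝒢 : ProfiniteSemiGraph.{u}} (c : TemperedPiChart 𝒢)
  {PA : Type u} [Group PA] [TopologicalSpace PA] [IsTopologicalGroup PA]
  (ρ : PA →* TopOut c.G) (baseAct : PA →* Aut 𝒢.graph)

/-- **Prop 5.2 (iv) with the tempered topology, on the carrier `π₁^temp(𝒢) ⋊^out Π_A`**: given the
Prop 3.6 hypotheses (temp-slimness of `π₁^temp(𝒢)`), `Π_A` tempered (e.g. profinite), the Def 5.1 (i)
binders `hV`/`hE`/`hopen` of the algebraic half, and an antitone sequence of normal subgroups `K n` of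
`π₁^temp(𝒢) ⋊^out Π_A` with open cofinal traces on `π₁^temp(𝒢)` and open images in `Π_A` (the kernels of
the arithmetic tree levels), there is a topology on `π₁^temp(𝒢) ⋊^out Π_A` which is a TEMPERED group
topology with basis of neighbourhoods of `1` the `K n ⊓ aug⁻¹U`, every `K n` open, `ι` a closed embedding,
`aug` continuous open surjective, the sequence `1 → π₁^temp(𝒢) → π₁^temp(𝒢) ⋊^out Π_A → Π_A → 1` exact
and Def 5.1 (i) on the chart (`ArithChartAction`). [cite: MochizukiSemiAnbd2006, Prop 5.2 (iv), p. 64] -/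
theorem exists_topology_arithTemperedGroup_of_kernelSeq (h36 : 𝒢.Prop36Hypotheses)
    (hA : IsTempered PA)
    (hV : ∀ (a : PA) (v : 𝒢.graph.Vertex) (H : Subgroup c.G), H ∈ verticialSubgroups c v →
      ∃ φ : contMulAut c.G, TopOut.mk c.G φ = ρ a ∧
        H.map (φ : MulAut c.G).toMonoidHom ∈ verticialSubgroups c ((baseAct a).hom.vertexMap v))
    (hE : ∀ (a : PA) (e : 𝒢.graph.Edge) (K : Subgroup c.G), K ∈ edgeLikeSubgroups c e →
      ∃ φ : contMulAut c.G, TopOut.mk c.G φ = ρ a ∧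
        K.map (φ : MulAut c.G).toMonoidHom ∈ edgeLikeSubgroups c ((baseAct a).hom.edgeMap e))
    (hopen : ∃ U : Subgroup PA, IsOpen (U : Set PA) ∧ ∀ a ∈ U,
      (∀ v, (baseAct a).hom.vertexMap v = v) ∧ (∀ e, (baseAct a).hom.edgeMap e = e) ∧
        ∀ b, (baseAct a).hom.branchMap b = b)
    (K : ℕ → Subgroup (outerSemidirectProduct ρ)) (hanti : Antitone K) (hnormal : ∀ n, (K n).Normal)
    (hK1 : ∀ n, IsOpen (((K n).comap (toOuterSemidirectProduct ρ) : Subgroup c.G) : Set c.G))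
    (hK1' : ∀ n, IsOpen (((K n).map (outerSemidirectProductSnd ρ) : Subgroup PA) : Set PA))
    (hK3 : ∀ U ∈ 𝓝 (1 : c.G), ∃ n,
      (((K n).comap (toOuterSemidirectProduct ρ) : Subgroup c.G) : Set c.G) ⊆ U) :
    ∃ τ : TopologicalSpace (outerSemidirectProduct ρ),
      @IsTopologicalGroup (outerSemidirectProduct ρ) τ _ ∧
      (@nhds _ τ 1).HasBasis (fun _ : ℕ × OpenNormalSubgroup PA => True)
        (fun nU => ((K nU.1 ⊓ nU.2.toSubgroup.comap (outerSemidirectProductSnd ρ) :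
          Subgroup (outerSemidirectProduct ρ)) : Set (outerSemidirectProduct ρ))) ∧
      (∀ n, @IsOpen _ τ (K n)) ∧ @IsTempered (outerSemidirectProduct ρ) _ τ ∧
      @IsEmbedding _ _ _ τ (toOuterSemidirectProduct ρ) ∧
      @IsClosed _ τ (Set.range (toOuterSemidirectProduct ρ)) ∧
      @Continuous _ _ τ _ (outerSemidirectProductSnd ρ) ∧
      @IsOpenMap _ _ τ _ (outerSemidirectProductSnd ρ) ∧
      Function.Injective (toOuterSemidirectProduct ρ) ∧
      (toOuterSemidirectProduct ρ).range = (outerSemidirectProductSnd ρ).ker ∧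
      Function.Surjective (outerSemidirectProductSnd ρ) ∧
      ArithChartAction c (toOuterSemidirectProduct ρ) (outerSemidirectProductSnd ρ)
        (fun a v => (baseAct a).hom.vertexMap v) (fun a e => (baseAct a).hom.edgeMap e)
        (fun a b => (baseAct a).hom.branchMap b) := by
  obtain ⟨hinj, hex, hsurj⟩ := outerAction_exact c ρ h36
  obtain ⟨τ, hτ, hb, hopenK, htemp, hemb, hcl, hcont, hopenmap⟩ :=
    TemperedExtension.exists_isTempered_topology_of_kernelSeq (toOuterSemidirectProduct ρ)
      (outerSemidirectProductSnd ρ) K c.isTempered hA hinj hex hsurj hanti hnormal hK1 hK1' hK3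
  exact ⟨τ, hτ, hb, hopenK, htemp, hemb, hcl, hcont, hopenmap, hinj, hex, hsurj,
    arithChartAction_outerAction c ρ baseAct hV hE hopen⟩

/-- **The shape WANTED by GAP-LEDGER G-w4d053-1** («the real arithmetic tempered fundamental group with
its chart action»), modulo the tower inputs: there EXIST a TEMPERED topological group `Π^temp_𝔊` in the
universe of `𝒢`, continuous homomorphisms `ι : π₁^temp(𝒢) → Π^temp_𝔊` (injective, indeed a closed
embedding) and `aug : Π^temp_𝔊 → Π_A` (surjective, indeed open) with `range ι = ker aug`, and Def 5.1 (i)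
on the chart (`ArithChartAction`).  Witness: `π₁^temp(𝒢) ⋊^out Π_A` with the topology of
`exists_topology_arithTemperedGroup_of_kernelSeq`. [cite: MochizukiSemiAnbd2006, Prop 5.2 (iv), p. 64] -/
theorem exists_arithTemperedGroup_of_kernelSeq (h36 : 𝒢.Prop36Hypotheses) (hA : IsTempered PA)
    (hV : ∀ (a : PA) (v : 𝒢.graph.Vertex) (H : Subgroup c.G), H ∈ verticialSubgroups c v →
      ∃ φ : contMulAut c.G, TopOut.mk c.G φ = ρ a ∧
        H.map (φ : MulAut c.G).toMonoidHom ∈ verticialSubgroups c ((baseAct a).hom.vertexMap v))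
    (hE : ∀ (a : PA) (e : 𝒢.graph.Edge) (K : Subgroup c.G), K ∈ edgeLikeSubgroups c e →
      ∃ φ : contMulAut c.G, TopOut.mk c.G φ = ρ a ∧
        K.map (φ : MulAut c.G).toMonoidHom ∈ edgeLikeSubgroups c ((baseAct a).hom.edgeMap e))
    (hopen : ∃ U : Subgroup PA, IsOpen (U : Set PA) ∧ ∀ a ∈ U,
      (∀ v, (baseAct a).hom.vertexMap v = v) ∧ (∀ e, (baseAct a).hom.edgeMap e = e) ∧
        ∀ b, (baseAct a).hom.branchMap b = b)
    (K : ℕ → Subgroup (outerSemidirectProduct ρ)) (hanti : Antitone K) (hnormal : ∀ n, (K n).Normal)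
    (hK1 : ∀ n, IsOpen (((K n).comap (toOuterSemidirectProduct ρ) : Subgroup c.G) : Set c.G))
    (hK1' : ∀ n, IsOpen (((K n).map (outerSemidirectProductSnd ρ) : Subgroup PA) : Set PA))
    (hK3 : ∀ U ∈ 𝓝 (1 : c.G), ∃ n,
      (((K n).comap (toOuterSemidirectProduct ρ) : Subgroup c.G) : Set c.G) ⊆ U) :
    ∃ (Gtp : Type u) (_ : Group Gtp) (_ : TopologicalSpace Gtp) (_ : IsTopologicalGroup Gtp)
      (ι : c.G →ₜ* Gtp) (aug : Gtp →ₜ* PA),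
      Function.Injective ι ∧ ι.toMonoidHom.range = aug.toMonoidHom.ker ∧ Function.Surjective aug ∧
      IsTempered Gtp ∧ IsEmbedding ι ∧ IsClosed (Set.range ι) ∧ IsOpenMap aug ∧
      ArithChartAction c ι.toMonoidHom aug.toMonoidHom
        (fun a v => (baseAct a).hom.vertexMap v) (fun a e => (baseAct a).hom.edgeMap e)
        (fun a b => (baseAct a).hom.branchMap b) := by
  obtain ⟨τ, hτ, -, -, htemp, hemb, hcl, hcont, hopenmap, hinj, hex, hsurj, hact⟩ :=
    exists_topology_arithTemperedGroup_of_kernelSeq c ρ baseAct h36 hA hV hE hopen K hanti hnormal hK1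
      hK1' hK3
  letI := τ
  exact ⟨outerSemidirectProduct ρ, inferInstance, τ, hτ,
    ⟨toOuterSemidirectProduct ρ, hemb.continuous⟩, ⟨outerSemidirectProductSnd ρ, hcont⟩,
    hinj, hex, hsurj, htemp, hemb, hcl, hopenmap, hact⟩

end ProfiniteSemiGraph

end Literature.AnabelianGeometry.SemiGraphs
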